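import Literature.Analysis.FluidPDE.AxisymmetricVorticityTransport
import Literature.Analysis.FluidPDE.VorticityCalculus
import Literature.Analysis.FluidPDE.HadamardQuotient
import HarnessLib

/-!
# The vorticity of an axisymmetric swirl-free field: `ω = ω_θ e_θ = f · Jx` with `f = ω_θ / r` smooth

Analysis/FluidPDE support file (all results proved) on the decomposition path of the named fact
`Literature.Analysis.FluidPDE.KNSS2009_liouville_axisymmetric_no_swirl` (Koch–Nadirashvili–
Seregin–Šverák, Acta Math. 203 (2009) = arXiv:0709.3599, Theorem 5.2). The proof of Theorem 5.2
(arXiv p. 9–10) uses: "For axi-symmetric flows without swirl we have `ω_r = 0`, `ω_z = 0`, and we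
can write `ω = ω_θ e_θ`" and works with the scalar `ω_θ / r`, "actually a smooth function, even
across the `x₃`-axis, as long as `u` is smooth" (Remark 5.1). This file proves both statements
for a field `v : ℝ³ → ℝ³` which is axisymmetric (`Fluid.IsAxisymmetric`: `v (R_θ x) = R_θ (v x)`)
and swirl free (`Fluid.HasNoSwirl`: `x₀v₁ − x₁v₀ ≡ 0`):

* `curl_apply_two_eq_zero` (`ω_z = 0`) and `inner_curl_horizontal_eq_zero` (`ω_r = 0`, as
  `x₀ω₀ + x₁ω₁ = 0`), for `v ∈ C¹`: the four linear relations between `∂ᵢvⱼ`, `i, j ≤ 1`, given by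
  infinitesimal axisymmetry `Dv(x)[Jx] = J v(x)` and by differentiating `x₀v₁ − x₁v₀ ≡ 0`, force
  `∂₀v₁ = ∂₁v₀` off the axis, and continuity finishes;
* `curl_eq_hadamardQuotFst_smul_rotGen` (**`ω = f · Jx`**), for `v ∈ C²`: with the infinitesimal
  rotation `Jx = (−x₁, x₀, 0) = r e_θ` (`Fluid.rotGen`) and
  `f = hadamardQuotFst (y ↦ (curl v y)₁)` — Hadamard's smooth quotient `ω₁ / x₀`, available
  because `ω₁` vanishes on the plane `{x₀ = 0}` — one has `curl v x = f x • Jx` for *every* `x`;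
  thus `f = ω_θ / r` off the axis, and `f` is `Cⁿ` when `v` is `Cⁿ⁺²`
  (`contDiff_hadamardQuotFst_curl`);
* `isAxisymmetricScalar_hadamardQuotFst_curl`: `f` is an axisymmetric scalar (`f (R_θ x) = f x`).

## References

* G. Koch, N. Nadirashvili, G. Seregin, V. Šverák, *Liouville theorems for the Navier–Stokes
  equations and applications*, Acta Math. 203 (2009) = arXiv:0709.3599, §5, p. 9 (before
  (5.10)), Remark 5.1, proof of Theorem 5.2 (p. 10). [KochNadirashviliSereginSverak2009]
-/

noncomputable section

open Set Function Filter Topology WithLp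
open scoped RealInnerProductSpace Topology ContDiff

namespace Literature.Analysis.FluidPDE

/-! ### A continuity lemma: vanishing off a coordinate hyperplane -/

/-- A continuous function on `ℝ³` which vanishes at every point of the punctured line
`x + s e` (`s ≠ 0`) vanishes at `x`. [folklore] -/
theorem eq_zero_of_continuous_of_forall_line {g : EuclideanSpace ℝ (Fin 3) → ℝ} (hg : Continuous g)
    (x e : EuclideanSpace ℝ (Fin 3)) (h : ∀ s : ℝ, s ≠ 0 → g (x + s • e) = 0) : g x = 0 := by
  have hc : Tendsto (fun s : ℝ => g (x + s • e)) (𝓝[≠] 0) (𝓝 (g x)) := by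
    have h1 : Continuous fun s : ℝ => g (x + s • e) :=
      hg.comp (continuous_const.add (continuous_id.smul continuous_const))
    have h2 := h1.tendsto 0
    simp only [zero_smul, add_zero] at h2
    exact h2.mono_left nhdsWithin_le_nhds
  have hz : Tendsto (fun s : ℝ => g (x + s • e)) (𝓝[≠] 0) (𝓝 0) := by
    refine (tendsto_const_nhds (x := (0 : ℝ))).congr' ?_
    exact eventually_nhdsWithin_of_forall fun s hs => (h s hs).symm
  exact tendsto_nhds_unique hc hz

/-! ### `ω_z = 0` and `ω_r = 0` -/

section Structure

variable {v : EuclideanSpace ℝ (Fin 3) → EuclideanSpace ℝ (Fin 3)}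

/-- For a swirl-free field, `⟪Jx, Dv(x) h⟫ = −⟪Jh, v(x)⟫` for every direction `h` (differentiate
`⟪Jy, v(y)⟫ ≡ 0`). [folklore] -/
theorem HasNoSwirl.inner_rotGen_fderiv_apply (hsw : HasNoSwirl v) {x : EuclideanSpace ℝ (Fin 3)}
    (hd : DifferentiableAt ℝ v x) (h : EuclideanSpace ℝ (Fin 3)) :
    ⟪rotGen x, fderiv ℝ v x h⟫ = -⟪rotGen h, v x⟫ := by
  have hzero : swirl v = fun _ => 0 := funext hsw
  have h0 : fderiv ℝ (swirl v) x h = 0 := by rw [hzero]; simp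
  rw [fderiv_swirl_apply hd h] at h0
  linarith

/-- The third component of the curl in coordinates: `(curl v x)₂ = ∂₀v₁ − ∂₁v₀`. [folklore] -/
theorem curl_apply_two (v : EuclideanSpace ℝ (Fin 3) → EuclideanSpace ℝ (Fin 3))
    (x : EuclideanSpace ℝ (Fin 3)) :
    curl v x 2 = fderiv ℝ v x (EuclideanSpace.single 0 1) 1 - fderiv ℝ v x (EuclideanSpace.single 1 1) 0 := by
  simp [curl]

/-- **`ω_z = 0` for axisymmetric swirl-free fields** (KNSS 2009, p. 9: "for axi-symmetric flows
without swirl we have `ω_r = 0`, `ω_z = 0`"): for `v ∈ C¹` axisymmetric and swirl free,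
`(curl v x)₂ = 0` for every `x`. Off the axis this is linear algebra on the four relations
`Dv(x)[Jx] = J v(x)` (two components) and `∂ₕ ⟪Jy, v⟫ = 0` (`h = e₀, e₁`); on the axis by
continuity. [cite: KochNadirashviliSereginSverak2009, §5 p. 9 (before (5.10))] -/
theorem curl_apply_two_eq_zero (hax : IsAxisymmetric v) (hsw : HasNoSwirl v) (hv : ContDiff ℝ 1 v)
    (x : EuclideanSpace ℝ (Fin 3)) : curl v x 2 = 0 := by
  have hd : ∀ y, DifferentiableAt ℝ v y := fun y => (hv.differentiable one_ne_zero) y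
  -- off the plane `{x₀ = 0}`
  have hoff : ∀ y : EuclideanSpace ℝ (Fin 3), y 0 ≠ 0 → curl v y 2 = 0 := by
    intro y hy0
    set D := fderiv ℝ v y with hD
    -- (i) `h = e₀` in the swirl relation, (iii) component `0` of infinitesimal axisymmetry
    have h1 := hsw.inner_rotGen_fderiv_apply (hd y) (EuclideanSpace.single 0 1)
    have h3 := hax.fderiv_rotGen (hd y)
    rw [rotGen_single_zero, inner_rotGen_left] at h1
    have h3' := congrFun (congrArg (⇑) h3) 0
    rw [rotGen_eq_sub_single y, map_sub, map_smul, map_smul] at h3'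
    simp only [PiLp.sub_apply, PiLp.smul_apply, smul_eq_mul, rotGen_apply_zero] at h3'
    have e1 : ⟪(EuclideanSpace.single (1 : Fin 3) (1 : ℝ)), v y⟫ = v y 1 := by
      simp [PiLp.inner_apply]
    rw [e1] at h1
    -- `h1 : y0 * (D e₀)₁ − y1 * (D e₀)₀ = −v₁`, `h3' : y0 * (D e₁)₀ − y1 * (D e₀)₀ = −v₁`
    rw [curl_apply_two]
    have key : y 0 * (fderiv ℝ v y (EuclideanSpace.single 0 1) 1 -
        fderiv ℝ v y (EuclideanSpace.single 1 1) 0) = 0 := by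
      rw [← hD] at h1 h3' ⊢
      linarith
    exact (mul_eq_zero.1 key).resolve_left hy0
  -- on the plane, by continuity along `y + s e₀`
  have hcont : Continuous fun y => curl v y 2 :=
    (contDiff_piLp_apply (𝕜 := ℝ) (p := 2) (n := 0) (i := (2 : Fin 3))).continuous.comp (continuous_curl hv)
  by_cases hx : x 0 = 0
  · refine eq_zero_of_continuous_of_forall_line hcont x (EuclideanSpace.single 0 1) fun s hs => ?_
    exact hoff _ (by simp [hx, hs])
  · exact hoff x hx

/-- **`ω_r = 0` for axisymmetric swirl-free fields** (KNSS 2009, p. 9), in the junk-free form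
`x₀ ω₀ + x₁ ω₁ = 0`: by the tree's `IsAxisymmetric.inner_curl_horizontal`,
`⟪ω, x_h⟫ = −⟪Jx, Dv e_z⟫ = ⟪J e_z, v⟫ = 0`. [cite: KochNadirashviliSereginSverak2009, §5 p. 9 (before (5.10))] -/
theorem inner_curl_horizontal_eq_zero (hax : IsAxisymmetric v) (hsw : HasNoSwirl v)
    {x : EuclideanSpace ℝ (Fin 3)} (hd : DifferentiableAt ℝ v x) :
    x 0 * curl v x 0 + x 1 * curl v x 1 = 0 := by
  have h := hax.inner_curl_horizontal hd
  rw [hsw.inner_rotGen_fderiv_apply hd, rotGen_single_two, inner_zero_left] at h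
  have e : ⟪curl v x, (toLp 2 ![x 0, x 1, 0] : EuclideanSpace ℝ (Fin 3))⟫ =
      x 0 * curl v x 0 + x 1 * curl v x 1 := by
    simp [PiLp.inner_apply, Fin.sum_univ_three]
  rw [e] at h
  simpa using h

/-- A `C⁰` vector field `ω` on `ℝ³` with `x₀ω₀ + x₁ω₁ ≡ 0` has `ω₁ = 0` on the plane `{x₀ = 0}`
(off the axis from `x₁ ω₁ = 0`, on the axis by continuity along `x + s e₁`). [folklore] -/
theorem apply_one_eq_zero_of_horizontal {w : EuclideanSpace ℝ (Fin 3) → EuclideanSpace ℝ (Fin 3)}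
    (hw : Continuous w) (hb : ∀ y : EuclideanSpace ℝ (Fin 3), y 0 * w y 0 + y 1 * w y 1 = 0)
    {x : EuclideanSpace ℝ (Fin 3)} (hx : x 0 = 0) : w x 1 = 0 := by
  have hoff : ∀ y : EuclideanSpace ℝ (Fin 3), y 0 = 0 → y 1 ≠ 0 → w y 1 = 0 := by
    intro y hy0 hy1
    have h := hb y
    rw [hy0, zero_mul, zero_add] at h
    exact (mul_eq_zero.1 h).resolve_left hy1
  have hcont : Continuous fun y => w y 1 :=
    (contDiff_piLp_apply (𝕜 := ℝ) (p := 2) (n := 0) (i := (1 : Fin 3))).continuous.comp hw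
  by_cases hx1 : x 1 = 0
  · refine eq_zero_of_continuous_of_forall_line hcont x (EuclideanSpace.single 1 1) fun s hs => ?_
    exact hoff _ (by simp [hx]) (by simp [hx1, hs])
  · exact hoff x hx hx1

/-- Consequence: for an axisymmetric swirl-free `C¹` field the component `ω₁` of the vorticity
vanishes on the plane `{x₀ = 0}`. [folklore] -/
theorem curl_apply_one_eq_zero_of_apply_zero (hax : IsAxisymmetric v) (hsw : HasNoSwirl v)
    (hv : ContDiff ℝ 1 v) {x : EuclideanSpace ℝ (Fin 3)} (hx : x 0 = 0) : curl v x 1 = 0 :=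
  apply_one_eq_zero_of_horizontal (continuous_curl hv)
    (fun y => inner_curl_horizontal_eq_zero hax hsw ((hv.differentiable one_ne_zero) y)) hx

/-! ### `ω = f · Jx` with the Hadamard quotient `f = ω₁ / x₀` -/

/-- **Horizontal rotational fields are `f · J`.** Let `ω : ℝ³ → ℝ³` be `C¹` with `ω₂ ≡ 0` and
`x₀ω₀ + x₁ω₁ ≡ 0` (i.e. `ω_z = 0`, `ω_r = 0`). Then `ω x = f x • Jx` for every `x`, with
`Jx = (−x₁, x₀, 0)` and the Hadamard quotient `f = hadamardQuotFst (y ↦ (ω y)₁)` (`= ω₁ / x₀`,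
smooth across `{x₀ = 0}` since `ω₁` vanishes there): `x₀ f = ω₁` by Hadamard's lemma, and
`x₁ f = −ω₀` off `{x₀ = 0}` from `x₀ω₀ + x₁ω₁ = 0`, then everywhere by continuity. [folklore] -/
theorem eq_hadamardQuotFst_smul_rotGen {w : EuclideanSpace ℝ (Fin 3) → EuclideanSpace ℝ (Fin 3)}
    (hw1 : ContDiff ℝ 1 w) (h2 : ∀ y : EuclideanSpace ℝ (Fin 3), w y 2 = 0)
    (hb : ∀ y : EuclideanSpace ℝ (Fin 3), y 0 * w y 0 + y 1 * w y 1 = 0)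
    (x : EuclideanSpace ℝ (Fin 3)) : w x = hadamardQuotFst (fun y => w y 1) x • rotGen x := by
  have hw : ContDiff ℝ 1 fun y => w y 1 :=
    (contDiff_piLp_apply (𝕜 := ℝ) (p := 2) (n := 1) (i := (1 : Fin 3))).comp hw1
  set f := hadamardQuotFst (fun y => w y 1) with hf
  have hfc : Continuous f :=
    (contDiff_hadamardQuotFst (n := 0) (by exact_mod_cast hw)).continuous
  -- `x₀ f = w₁` (Hadamard)
  have h1 : ∀ y : EuclideanSpace ℝ (Fin 3), y 0 * f y = w y 1 := fun y =>
    smul_hadamardQuotFst hw (fun z hz => apply_one_eq_zero_of_horizontal hw1.continuous hb hz) y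
  -- `w₀ + x₁ f = 0`: off `{x₀ = 0}` from `x₀w₀ + x₁w₁ = 0`, then by continuity
  have h0 : ∀ y : EuclideanSpace ℝ (Fin 3), w y 0 + y 1 * f y = 0 := by
    have hoff : ∀ y : EuclideanSpace ℝ (Fin 3), y 0 ≠ 0 → w y 0 + y 1 * f y = 0 := by
      intro y hy
      have h := hb y
      rw [← h1 y] at h
      have : y 0 * (w y 0 + y 1 * f y) = 0 := by linarith
      exact (mul_eq_zero.1 this).resolve_left hy
    have hcont : Continuous fun y : EuclideanSpace ℝ (Fin 3) => w y 0 + y 1 * f y :=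
      ((contDiff_piLp_apply (𝕜 := ℝ) (p := 2) (n := 0) (i := (0 : Fin 3))).continuous.comp
        hw1.continuous).add
        ((contDiff_piLp_apply (𝕜 := ℝ) (p := 2) (n := 0) (i := (1 : Fin 3))).continuous.mul hfc)
    intro y
    by_cases hy : y 0 = 0
    · refine eq_zero_of_continuous_of_forall_line hcont y (EuclideanSpace.single 0 1) fun s hs => ?_
      exact hoff _ (by simp [hy, hs])
    · exact hoff y hy
  ext i
  fin_cases i
  · simp only [Fin.zero_eta, PiLp.smul_apply, rotGen_apply_zero, smul_eq_mul]
    linarith [h0 x]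
  · simp only [Fin.mk_one, PiLp.smul_apply, rotGen_apply_one, smul_eq_mul]
    linarith [h1 x]
  · simp only [Fin.reduceFinMk, PiLp.smul_apply, rotGen_apply_two, smul_eq_mul, mul_zero]
    exact h2 x

/-- **Structure of the vorticity of an axisymmetric swirl-free field** (KNSS 2009, p. 9–10:
`ω = ω_θ e_θ`, with `ω_θ / r` smooth across the axis, Remark 5.1). For `v ∈ C²` axisymmetric and
swirl free, and `f = hadamardQuotFst (y ↦ (curl v y)₁)` (Hadamard's quotient `ω₁ / x₀`):
`curl v x = f x • Jx` for every `x`, where `Jx = (−x₁, x₀, 0) = r e_θ`; i.e. `ω₀ = −x₁ f`,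
`ω₁ = x₀ f`, `ω₂ = 0`, and `f = ω_θ / r` off the axis. [cite: KochNadirashviliSereginSverak2009, §5 pp. 9–10 and Remark 5.1] -/
theorem curl_eq_hadamardQuotFst_smul_rotGen (hax : IsAxisymmetric v) (hsw : HasNoSwirl v)
    (hv : ContDiff ℝ 2 v) (x : EuclideanSpace ℝ (Fin 3)) :
    curl v x = hadamardQuotFst (fun y => curl v y 1) x • rotGen x := by
  have hv1 : ContDiff ℝ 1 v := hv.of_le one_le_two
  have hω : ContDiff ℝ 1 (curl v) := contDiff_curl (n := 1) (by exact_mod_cast hv)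
  exact eq_hadamardQuotFst_smul_rotGen hω (curl_apply_two_eq_zero hax hsw hv1)
    (fun y => inner_curl_horizontal_eq_zero hax hsw ((hv1.differentiable one_ne_zero) y)) x

/-- **Smoothness of `f = ω_θ / r`** (KNSS 2009, Remark 5.1): for `v ∈ Cⁿ⁺²` (written
`(n + 1) + 1`) the Hadamard quotient `hadamardQuotFst (y ↦ (curl v y)₁)` is `Cⁿ`. [cite: KochNadirashviliSereginSverak2009, Remark 5.1 (arXiv p. 9)] -/
theorem contDiff_hadamardQuotFst_curl {n : ℕ∞} (hv : ContDiff ℝ ((n + 1 : ℕ∞) + 1) v) :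
    ContDiff ℝ n (hadamardQuotFst fun y => curl v y 1) := by
  have hω : ContDiff ℝ (n + 1) (curl v) := contDiff_curl (n := n + 1) hv
  exact contDiff_hadamardQuotFst
    ((contDiff_piLp_apply (𝕜 := ℝ) (p := 2) (n := n + 1) (i := (1 : Fin 3))).comp hω)

/-- The infinitesimal rotation commutes with the rotations about the axis: `J (R_θ x) = R_θ (J x)`.
[folklore] -/
theorem rotGen_rotZ (θ : ℝ) (x : EuclideanSpace ℝ (Fin 3)) : rotGen (rotZ θ x) = rotZ θ (rotGen x) := by
  ext i
  fin_cases i <;> simp [rotGen] <;> ring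

/-- A point on the axis is fixed by the rotations about the axis. [folklore] -/
theorem rotZ_eq_self_of_axis (θ : ℝ) {x : EuclideanSpace ℝ (Fin 3)} (h0 : x 0 = 0) (h1 : x 1 = 0) :
    rotZ θ x = x := by
  ext i
  fin_cases i <;> simp [h0, h1]

/-- **`f = ω_θ / r` is an axisymmetric scalar**: `f (R_θ x) = f x` for the Hadamard quotient of an
axisymmetric swirl-free `C²` field (from `ω (R_θ x) = R_θ ω(x)`, `ω = f · J` and `J R_θ = R_θ J`;
KNSS 2009, p. 9: the cylindrical components depend only on `r, z`). [cite: KochNadirashviliSereginSverak2009, §5 p. 9] -/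
theorem isAxisymmetricScalar_hadamardQuotFst_curl (hax : IsAxisymmetric v) (hsw : HasNoSwirl v)
    (hv : ContDiff ℝ 2 v) : IsAxisymmetricScalar (hadamardQuotFst fun y => curl v y 1) := by
  intro θ x
  set f := hadamardQuotFst (fun y => curl v y 1) with hf
  have hωax : IsAxisymmetric (curl v) := hax.curl (hv.differentiable (by norm_num))
  have h := hωax θ x
  rw [curl_eq_hadamardQuotFst_smul_rotGen hax hsw hv (rotZ θ x),
    curl_eq_hadamardQuotFst_smul_rotGen hax hsw hv x, rotGen_rotZ] at h
  -- `h : f (R x) • R (J x) = R (f x • J x) = f x • R (J x)`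
  have hlin : rotZ θ (f x • rotGen x) = f x • rotZ θ (rotGen x) := by
    ext i; fin_cases i <;> simp <;> ring
  rw [hlin] at h
  have hsub : (f (rotZ θ x) - f x) • rotZ θ (rotGen x) = 0 := by rw [sub_smul, h, sub_self]
  by_cases hax' : x 0 = 0 ∧ x 1 = 0
  · rw [rotZ_eq_self_of_axis θ hax'.1 hax'.2]
  · -- off the axis `R (J x) ≠ 0`
    have hne : rotZ θ (rotGen x) ≠ 0 := by
      intro hz
      have hn : ‖rotZ θ (rotGen x)‖ = 0 := by rw [hz, norm_zero]
      rw [norm_rotZ, norm_eq_zero] at hn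
      have h0' := congrFun (congrArg (⇑) hn) 0
      have h1' := congrFun (congrArg (⇑) hn) 1
      simp only [rotGen_apply_zero, rotGen_apply_one, PiLp.zero_apply, neg_eq_zero] at h0' h1'
      exact hax' ⟨h1', h0'⟩
    have := (smul_eq_zero.1 hsub).resolve_right hne
    linarith

end Structure

end Literature.Analysis.FluidPDE

end
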